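import Literature.MathematicalPhysics.KineticTheory.SerrePeriodicPayload
import Literature.Analysis.FluidPDE.CollisionPayload
import Literature.Analysis.FluidPDE.HardSphereTimeScaling
import HarnessLib

/-!
# Serre's periodic payload bound: elementary a-priori layer (proofs)

Companion of `Literature.MathematicalPhysics.KineticTheory.SerrePeriodicPayload`, which vendors
as the named fact `SerrePeriodicPayloadBound` D. Serre's weighted collision estimate for hard
spheres in a periodic box (Serre 2024, Thm. 6 with (7); proved in §5 as (19)–(20)):
`Σ_coll |[v]| ≤_d N (√(N E) + E T / L)` on `(0, T) × L𝕋ᵈ` whenever `N a < θ(d) L`.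

Serre's proof rests on Compensated Integrability for divergence-controlled positive symmetric
tensors on `ℝᵏ × 𝕋ᵐ` (Serre 2024 Thms. 1, 3) with determinantal masses at the nodes of the
particle graph (Thm. 11: Minkowski problem / Pogorelov, John's theorem), applied to the Div-free
mass–momentum tensor of the billiard (Serre 2021, ref. [12] of the paper); none of that machinery
is in Mathlib or in this library yet, and the estimate itself is NOT proved here. This file adds
to the payload vocabulary of `Literature.Analysis.FluidPDE.CollisionPayload` (`velocityJump`,
`collisionPayload`, `velocityJump_eq`: a binary collision contributes `2 |[v]|`) the elementary
a-priori facts around the statement: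

* `serrePeriodicPayloadBound_iff` — the fact is literally a bound on
  `collisionPayload (Torus.geometry (Fin 3)) ε γ a b` (definitional);
* `collidePair_vel_sub_left` / `collidePair_vel_sub_right` / `collidePair_vel_sub_right_eq_neg` —
  the two jumps of a binary elastic collision are the opposite vectors
  `∓ (⟪v_i − v_j, n⟫ / |n|²) n` (Serre's `[v] := v⁺(p) − v⁻(p) = v⁻(q) − v⁺(q)`, conservation of
  momentum at a node of the particle graph, §5 p. 1438 — the identity that makes the
  mass–momentum tensor Div-free at the nodes);
* weak vs strong collisions: `abs_inner_div_norm_le_norm` (`|[v]| ≤ |v_i − v_j|`, Cauchy–Schwarz)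
  and `norm_vel_sub_vel_le` (`|v_i − v_j| ≤ 2 √E`, `E = ½ Σ |v_k|²`), hence one collision carries
  payload `≤ 4 √E` (`sum_norm_collidePair_vel_sub_le`,
  `IsHardSphereTrajectory.velocityJump_le`);
* the crude a-priori bound `IsHardSphereTrajectory.collisionPayload_le_mul_numCollisions`:
  `collisionPayload ≤ 4 √E(γ a) · #collisions([a, b])` (energy conservation
  `IsHardSphereTrajectory.configEnergy_eq_holds` and local finiteness). This is the finiteness of
  `Σ_coll |[v]|` over bounded windows used in Serre's absorption step (18) → (19); it is NOT
  Serre's estimate (the number of collisions of `N` balls admits no polynomial bound,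
  Burago–Ivanov), which weights each collision by `|[v]|` precisely to beat the counting;
* vacuity guards: `collisionTimes_eq_empty_of_le_one`, `collisionPayload_eq_zero_of_le_one`
  (`K ≤ 1` spheres never collide, so there the inequality of the fact only asks `0 ≤ RHS`).
* **`serrePeriodicPayloadBound_of_inhomogeneous`** — Serre's scaling-and-absorption step
  (§5 pp. 1439–1440, (18) ⇒ (19)–(20)): the dimensionally inhomogeneous inequality
  `pay ≤ C (K + √(KE) + (b−a)E + ε·pay)²` for all trajectories and windows (the raw output of
  compensated integrability with determinantal masses, Serre's (18)) implies
  `SerrePeriodicPayloadBound`, via the time dilation `timeDilate μ γ` of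
  `Literature.Analysis.FluidPDE.HardSphereTimeScaling` optimised in `μ` and the absorption of the
  payload term for `K ε < 1/(8 max(C,1))`. What remains for `SerrePeriodicPayloadBound_holds` is
  exactly the hypothesis of this theorem.

## References

* D. Serre, *Compensated integrability on tori; a priori estimate for space-periodic gas flows*,
  C. R. Math. Acad. Sci. Paris 362 (2024) 1425–1444, doi:10.5802/crmath.654, §1.4 Thm. 6, §5
  (pp. 1438–1440). [Serre2024]
* D. Serre, *Hard spheres dynamics: weak vs strong collisions*, Arch. Ration. Mech. Anal. 240
  (2021) 243–264, Thm. 1.1. [Serre2021]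
-/

noncomputable section

open scoped InnerProductSpace
open Set Filter Function

namespace Literature.MathematicalPhysics.KineticTheory

open Literature.Analysis.FluidPDE

/-- `SerrePeriodicPayloadBound` is a bound on the collision payload
`collisionPayload (Torus.geometry (Fin 3)) ε γ a b` of `Literature.Analysis.FluidPDE.CollisionPayload`
(whose body is literally the inlined `finsum`). [cite: Serre2024, Thm. 6 with (7)] -/
theorem serrePeriodicPayloadBound_iff :
    SerrePeriodicPayloadBound ↔
      ∃ κ : ℝ, 0 < κ ∧ ∃ c : ℝ, ∀ (K : ℕ) (ε : ℝ), 0 < ε → (K : ℝ) * ε < κ →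
        ∀ γ : ℝ → Config K (Fin 3) T3, IsHardSphereTrajectory (Torus.geometry (Fin 3)) ε K γ →
          ∀ a b : ℝ, a ≤ b →
            collisionPayload (Torus.geometry (Fin 3)) ε γ a b ≤
              c * ((K : ℝ) ^ ((3 : ℝ) / 2) * Real.sqrt (configEnergy (γ a)) +
                (b - a) * (K : ℝ) * configEnergy (γ a)) :=
  Iff.rfl

section Jump

variable {d : Type*} [Fintype d] {X : Type*} {N : ℕ} {G : Geometry d X} {i j : Fin N}

/-- The velocity jump of the first particle of a colliding pair:
`v_i⁺ − v_i = −(⟪v_i − v_j, n⟫ / |n|²) n`, `n` the separation vector (GST 2013 (1.1.2)–(1.1.3);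
Serre's `−[v]` read on particle `q`). [cite: Serre2024, §5 p. 1438] -/
theorem collidePair_vel_sub_left (hij : i ≠ j) (z : Config N d X) :
    (collidePair G i j z i).2 - (z i).2 =
      -((⟪(z i).2 - (z j).2, G.sepVec (z i).1 (z j).1⟫_ℝ / ‖G.sepVec (z i).1 (z j).1‖ ^ 2) •
        G.sepVec (z i).1 (z j).1) := by
  rw [collidePair_apply_left hij]
  simp only [reflectVel]
  abel

/-- The velocity jump of the second particle of a colliding pair:
`v_j⁺ − v_j = (⟪v_i − v_j, n⟫ / |n|²) n`. [cite: Serre2024, §5 p. 1438] -/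
theorem collidePair_vel_sub_right (z : Config N d X) :
    (collidePair G i j z j).2 - (z j).2 =
      (⟪(z i).2 - (z j).2, G.sepVec (z i).1 (z j).1⟫_ℝ / ‖G.sepVec (z i).1 (z j).1‖ ^ 2) •
        G.sepVec (z i).1 (z j).1 := by
  rw [collidePair_apply_right]
  simp only [reflectVel]
  abel

/-- Conservation of momentum at a node, in Serre's form
`[v] := v⁺(p) − v⁻(p) = v⁻(q) − v⁺(q)`: the two jumps of a binary elastic collision are opposite
vectors. [cite: Serre2024, §5 p. 1438] -/
theorem collidePair_vel_sub_right_eq_neg (hij : i ≠ j) (z : Config N d X) :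
    (collidePair G i j z j).2 - (z j).2 = -((collidePair G i j z i).2 - (z i).2) := by
  rw [collidePair_vel_sub_left hij, collidePair_vel_sub_right, neg_neg]

omit [Fintype d] in
/-- Weak vs strong collisions: `|⟪v, n⟫| / |n| ≤ |v|` (Cauchy–Schwarz), i.e. Serre's weight
`|[v]|` of a collision is at most the relative speed `|v_i − v_j|` of the pair; a collision is
"negligible" when `|[v]| ≪ |v_i − v_j|` (Serre 2021). For `n = 0` the left side is `0`.
[cite: Serre2021, Thm. 1.1] -/
theorem abs_inner_div_norm_le_norm [Fintype d] (v n : EuclideanSpace ℝ d) :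
    |⟪v, n⟫_ℝ| / ‖n‖ ≤ ‖v‖ := by
  by_cases hn : ‖n‖ = 0
  · simp [hn]
  · rw [div_le_iff₀ (lt_of_le_of_ne (norm_nonneg _) (Ne.symm hn))]
    exact abs_real_inner_le_norm v n

/-- The relative speed of a pair is at most `2 √E`, `E = ½ Σ_k |v_k|²` the kinetic energy of the
configuration (`(|v_i| + |v_j|)² ≤ 2 (|v_i|² + |v_j|²) ≤ 4 E`). [folklore] -/
theorem norm_vel_sub_vel_le (hij : i ≠ j) (z : Config N d X) :
    ‖(z i).2 - (z j).2‖ ≤ 2 * Real.sqrt (configEnergy z) := by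
  classical
  have hsum : ‖(z i).2‖ ^ 2 + ‖(z j).2‖ ^ 2 ≤ ∑ k, ‖(z k).2‖ ^ 2 := by
    rw [← Finset.sum_pair (f := fun k => ‖(z k).2‖ ^ 2) hij]
    exact Finset.sum_le_sum_of_subset_of_nonneg (Finset.subset_univ _) fun _ _ _ => sq_nonneg _
  have hE : ∑ k, ‖(z k).2‖ ^ 2 = 2 * configEnergy z := by
    simp only [configEnergy]
    ring
  have hE0 : 0 ≤ configEnergy z := by
    unfold configEnergy
    positivity
  have h2 : (‖(z i).2‖ + ‖(z j).2‖) ^ 2 ≤ (2 * Real.sqrt (configEnergy z)) ^ 2 := by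
    rw [mul_pow, Real.sq_sqrt hE0]
    nlinarith [sq_nonneg (‖(z i).2‖ - ‖(z j).2‖)]
  have h3 : ‖(z i).2‖ + ‖(z j).2‖ ≤ 2 * Real.sqrt (configEnergy z) :=
    (abs_le_of_sq_le_sq' h2 (by positivity)).2
  exact (norm_sub_le _ _).trans h3

/-- One binary elastic collision carries payload at most `4 √E`:
`Σ_k ‖v_k⁺ − v_k‖ = 2 |[v]| ≤ 2 |v_i − v_j| ≤ 4 √E` (with `sum_norm_collidePair_vel_sub` and
`norm_collidePair_vel_sub` of `CollisionPayload`). [folklore] -/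
theorem sum_norm_collidePair_vel_sub_le (hij : i ≠ j) (z : Config N d X) :
    ∑ k, ‖(collidePair G i j z k).2 - (z k).2‖ ≤ 4 * Real.sqrt (configEnergy z) := by
  rw [sum_norm_collidePair_vel_sub hij, norm_collidePair_vel_sub hij]
  have h1 := abs_inner_div_norm_le_norm ((z i).2 - (z j).2) (G.sepVec (z i).1 (z j).1)
  have h2 := norm_vel_sub_vel_le hij z
  linarith

/-- With at most one sphere there are no pairs, hence no collision times. [folklore] -/
theorem collisionTimes_eq_empty_of_le_one {K : ℕ} (hK : K ≤ 1) (G : Geometry d X) (ε : ℝ)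
    (γ : ℝ → Config K d X) : collisionTimes G ε γ = ∅ := by
  haveI : Subsingleton (Fin K) := Fin.subsingleton_iff_le_one.2 hK
  ext t
  simp only [mem_collisionTimes, Set.mem_empty_iff_false, iff_false, not_exists, not_and]
  exact fun i j hij _ => hij (Subsingleton.elim i j)

/-- For `K ≤ 1` spheres every window payload vanishes (no collision times at all), so there the
inequality of `SerrePeriodicPayloadBound` holds as soon as its right-hand side is non-negative.
[folklore] -/
theorem collisionPayload_eq_zero_of_le_one [TopologicalSpace X] {K : ℕ} (hK : K ≤ 1)
    (G : Geometry d X) (ε : ℝ) (γ : ℝ → Config K d X) (a b : ℝ) :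
    collisionPayload G ε γ a b = 0 :=
  collisionPayload_eq_zero_of_forall_notMem fun t _ => by
    rw [collisionTimes_eq_empty_of_le_one hK]
    exact Set.notMem_empty t

end Jump

/-! ### Along a hard-sphere trajectory -/

section Trajectory

variable {d : Type*} [Fintype d] {X : Type*} {N : ℕ} [TopologicalSpace X] [T2Space X]
  {G : Geometry d X} {ε : ℝ} {γ : ℝ → Config N d X}

/-- The velocity jump of a hard-sphere trajectory at any single time is at most `4 √E(γ t)`:
either `t` is a collision time, the left limit is the incoming configuration and the value its
elastic reflection (`eq_collidePair_leftLim`; the reflection preserves the energy), or there is no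
jump at all (`velocityJump_eq_zero`; continuous translations). [folklore] -/
theorem _root_.Literature.Analysis.FluidPDE.IsHardSphereTrajectory.velocityJump_le
    (h : IsHardSphereTrajectory G ε N γ) (hG : ∀ x : X, Continuous (G.translate x)) (t : ℝ) :
    velocityJump γ t ≤ 4 * Real.sqrt (configEnergy (γ t)) := by
  by_cases ht : t ∈ collisionTimes G ε γ
  · obtain ⟨i, j, hij, hc⟩ := ht
    obtain ⟨-, heq⟩ := h.eq_collidePair_leftLim hij hc
    have hE : configEnergy (leftLim γ t) = configEnergy (γ t) := by
      conv_rhs => rw [heq]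
      rw [configEnergy_collidePair hij]
    have key := sum_norm_collidePair_vel_sub_le (G := G) hij (leftLim γ t)
    rw [← heq, hE] at key
    exact key
  · rw [h.velocityJump_eq_zero hG ht]
    positivity

/-- **Crude a-priori bound (finiteness of the payload).** Over a closed window the collision
payload of a hard-sphere trajectory is at most `4 √E · #collisions` (`numCollisions`, finite by
local finiteness of the collision times; the energy is conserved,
`IsHardSphereTrajectory.configEnergy_eq_holds`, so `E` may be read at time `a`). This is the
finiteness of `Σ_coll |[v]|` over bounded time intervals that Serre's absorption step (18) → (19)
uses; it is not Serre's estimate. [cite: Serre2024, §5 (18)–(19)] -/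
theorem _root_.Literature.Analysis.FluidPDE.IsHardSphereTrajectory.collisionPayload_le_mul_numCollisions
    (h : IsHardSphereTrajectory G ε N γ) (hG : ∀ x : X, Continuous (G.translate x)) (a b : ℝ) :
    collisionPayload G ε γ a b ≤
      4 * Real.sqrt (configEnergy (γ a)) * numCollisions G ε γ a b := by
  rw [h.collisionPayload_eq_sum a b, h.numCollisions_eq a b]
  calc ∑ t ∈ (h.locFinite a b).toFinset, velocityJump γ t
      ≤ ∑ _t ∈ (h.locFinite a b).toFinset, 4 * Real.sqrt (configEnergy (γ a)) :=
        Finset.sum_le_sum fun t _ => by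
          rw [IsHardSphereTrajectory.configEnergy_eq_holds h a t]
          exact h.velocityJump_le hG t
    _ = 4 * Real.sqrt (configEnergy (γ a)) * (h.locFinite a b).toFinset.card := by
        rw [Finset.sum_const, nsmul_eq_mul]
        ring

end Trajectory

/-! ### Serre's scaling and absorption step: (18) ⇒ (20) -/

section Reduction

/-- **Serre's scaling-and-absorption step** (Serre 2024 §5, pp. 1439–1440: (18) ⇒ (19) by the
change of time `τ = μt` optimised in `μ`, then absorption of `a Σ|[v]|` for `N a < θ(d)`; (20) by
the space scaling, vacuous here since the tree's torus is fixed). If the *dimensionally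
inhomogeneous* payload inequality — the raw output of Compensated Integrability with
determinantal masses applied to the mass–momentum tensor of the billiard, Serre's (18) —
`pay[a,b] ≤ C (K + √(K E) + (b − a) E + ε · pay[a,b])²` holds for every hard-sphere trajectory of
every number `K` of spheres of every diameter `ε` on `𝕋³` and every window, then
`SerrePeriodicPayloadBound` holds, with `κ = 1/(8 max(C,1))` and `c = 8 max(C,1)`. Proof: the
time dilation `γ_μ = timeDilate μ γ` is again a trajectory (`IsHardSphereTrajectory.timeDilate`)
with payload `μ · pay`, energy `μ² E` and window `(b − a)/μ`, so `μ · pay ≤ C (K + μ Q)²` for all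
`μ > 0`, `Q = √(KE) + (b−a)E + ε pay`; `μ = K/Q` gives `pay ≤ 4 C K Q`, and `4 C K ε ≤ 1/2`
absorbs the payload term. [cite: Serre2024, §5 (18)–(20), pp. 1439–1440] -/
theorem serrePeriodicPayloadBound_of_inhomogeneous
    (h18 : ∃ C : ℝ, ∀ (K : ℕ) (ε : ℝ), 0 < ε →
      ∀ γ : ℝ → Config K (Fin 3) T3, IsHardSphereTrajectory (Torus.geometry (Fin 3)) ε K γ →
        ∀ a b : ℝ, a ≤ b →
          collisionPayload (Torus.geometry (Fin 3)) ε γ a b ≤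
            C * ((K : ℝ) + Real.sqrt ((K : ℝ) * configEnergy (γ a)) +
              (b - a) * configEnergy (γ a) +
              ε * collisionPayload (Torus.geometry (Fin 3)) ε γ a b) ^ 2) :
    SerrePeriodicPayloadBound := by
  obtain ⟨C, hC⟩ := h18
  set C₁ : ℝ := max C 1 with hC₁
  have hC₁pos : 0 < C₁ := lt_of_lt_of_le one_pos (le_max_right C 1)
  -- the inequality with the larger constant
  have h18' : ∀ (K : ℕ) (ε : ℝ), 0 < ε →
      ∀ γ : ℝ → Config K (Fin 3) T3, IsHardSphereTrajectory (Torus.geometry (Fin 3)) ε K γ →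
        ∀ a b : ℝ, a ≤ b →
          collisionPayload (Torus.geometry (Fin 3)) ε γ a b ≤
            C₁ * ((K : ℝ) + Real.sqrt ((K : ℝ) * configEnergy (γ a)) +
              (b - a) * configEnergy (γ a) +
              ε * collisionPayload (Torus.geometry (Fin 3)) ε γ a b) ^ 2 :=
    fun K ε hε γ hγ a b hab =>
      (hC K ε hε γ hγ a b hab).trans (mul_le_mul_of_nonneg_right (le_max_left C 1) (sq_nonneg _))
  rw [serrePeriodicPayloadBound_iff]
  refine ⟨1 / (8 * C₁), by positivity, 8 * C₁, fun K ε hε hKε γ hγ a b hab => ?_⟩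
  set G := Torus.geometry (Fin 3) with hG
  set P : ℝ := collisionPayload G ε γ a b with hP
  set E : ℝ := configEnergy (γ a) with hE
  have hP0 : 0 ≤ P := collisionPayload_nonneg G ε γ a b
  have hE0 : 0 ≤ E := by
    rw [hE]
    unfold configEnergy
    positivity
  have hT0 : 0 ≤ b - a := sub_nonneg.2 hab
  have hRHS0 : 0 ≤ 8 * C₁ * ((K : ℝ) ^ ((3 : ℝ) / 2) * Real.sqrt E + (b - a) * K * E) := by
    positivity
  -- no particle, no collision
  rcases Nat.eq_zero_or_pos K with hK0 | hKpos
  · subst hK0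
    have hP00 : P = 0 := collisionPayload_eq_zero_of_le_one zero_le_one G ε γ a b
    rw [hP00]
    exact hRHS0
  have hK : (0 : ℝ) < K := Nat.cast_pos.2 hKpos
  -- the scaling family of inequalities
  set Q : ℝ := Real.sqrt (K * E) + (b - a) * E + ε * P with hQ
  have hQ0 : 0 ≤ Q := by positivity
  have key : ∀ μ : ℝ, 0 < μ → μ * P ≤ C₁ * ((K : ℝ) + μ * Q) ^ 2 := by
    intro μ hμ
    have hμ0 : μ ≠ 0 := hμ.ne'
    have htraj := hγ.timeDilate hμ
    have h := h18' K ε hε (timeDilate μ γ) htraj (a / μ) (b / μ)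
      (div_le_div_of_nonneg_right hab hμ.le)
    rw [collisionPayload_timeDilate hμ, configEnergy_timeDilate, mul_div_cancel₀ a hμ0,
      mul_div_cancel₀ b hμ0] at h
    have hsqrt : Real.sqrt ((K : ℝ) * (μ ^ 2 * E)) = μ * Real.sqrt (K * E) := by
      rw [show (K : ℝ) * (μ ^ 2 * E) = μ ^ 2 * (K * E) by ring,
        Real.sqrt_mul (sq_nonneg μ), Real.sqrt_sq hμ.le]
    have hre : (K : ℝ) + Real.sqrt ((K : ℝ) * (μ ^ 2 * E)) + (b / μ - a / μ) * (μ ^ 2 * E) +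
        ε * (μ * P) = K + μ * Q := by
      rw [hsqrt, hQ]
      field_simp
      ring
    calc μ * P ≤ _ := h
      _ = C₁ * ((K : ℝ) + μ * Q) ^ 2 := by rw [hre]
  -- optimise in μ
  rcases hQ0.eq_or_lt with hQz | hQpos
  · -- Q = 0: then μ P ≤ C₁ K² for all μ, so P = 0
    have hPz : P = 0 := by
      by_contra hPne
      have hPpos : 0 < P := lt_of_le_of_ne hP0 (Ne.symm hPne)
      have h := key ((C₁ * (K : ℝ) ^ 2 + 1) / P) (by positivity)
      rw [← hQz, mul_zero, add_zero, div_mul_cancel₀ _ hPpos.ne'] at h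
      linarith
    rw [hPz]
    exact hRHS0
  · have hQne : Q ≠ 0 := hQpos.ne'
    have hkey := key (K / Q) (div_pos hK hQpos)
    have hsimp : (K : ℝ) + K / Q * Q = 2 * K := by
      rw [div_mul_cancel₀ _ hQne]
      ring
    rw [hsimp, div_mul_eq_mul_div, div_le_iff₀ hQpos] at hkey
    -- hkey : K * P ≤ C₁ * (2K)² * Q
    have h1 : P ≤ 4 * C₁ * K * Q := by
      refine le_of_mul_le_mul_left ?_ hK
      calc (K : ℝ) * P ≤ C₁ * (2 * K) ^ 2 * Q := hkey
        _ = K * (4 * C₁ * K * Q) := by ring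
    have h1' : P ≤ 4 * C₁ * K * Real.sqrt (K * E) + 4 * C₁ * K * ((b - a) * E) +
        4 * C₁ * (K * ε) * P := by
      have : 4 * C₁ * ↑K * Q = 4 * C₁ * K * Real.sqrt (K * E) + 4 * C₁ * K * ((b - a) * E) +
          4 * C₁ * (K * ε) * P := by
        rw [hQ]
        ring
      linarith
    have hε' : 4 * C₁ * ((K : ℝ) * ε) ≤ 1 / 2 := by
      have h := mul_lt_mul_of_pos_left hKε (by positivity : (0 : ℝ) < 4 * C₁)
      have h' : 4 * C₁ * (1 / (8 * C₁)) = 1 / 2 := by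
        field_simp
        ring
      linarith
    have h3 : 4 * C₁ * ((K : ℝ) * ε) * P ≤ 1 / 2 * P :=
      mul_le_mul_of_nonneg_right hε' hP0
    have hpow : (K : ℝ) ^ ((3 : ℝ) / 2) * Real.sqrt E = K * Real.sqrt (K * E) := by
      rw [Real.sqrt_mul hK.le, ← mul_assoc, show (3 : ℝ) / 2 = 1 + 1 / 2 by norm_num,
        Real.rpow_add hK, Real.rpow_one, ← Real.sqrt_eq_rpow]
    rw [hpow]
    have h4 : 0 ≤ 4 * C₁ * (K : ℝ) * Real.sqrt (K * E) := by positivity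
    have h5 : 0 ≤ 4 * C₁ * (K : ℝ) * ((b - a) * E) := by positivity
    nlinarith [h1', h3, h4, h5]

end Reduction

end Literature.MathematicalPhysics.KineticTheory

end
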